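import Mathlib
import Summits.NavierStokesRegularity.NavierStokesRegularity.Theorems.FilamentSkeletonRssClause13PieceSymbolFacts
import Summits.NavierStokesRegularity.NavierStokesRegularity.Theorems.FilamentSkeletonRssClause13LiaSymbolNegWindowKernel
import Summits.NavierStokesRegularity.NavierStokesRegularity.Theorems.FilamentSkeletonRssClause13ModelLowDirichlet

/-!
# Kelvin excision — first lemmas for the crux idea `kelvin-excision-surgery` (crux `SkeletonJ1R`, stmt-NavierStokesRegularity-23610)

Crux-ideate round 1, ideator slot 1 (gen 11).  HONEST FRAMING: elementary facts about the explicit static self-induction symbol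
`𝔖 = liaSym` of the route's algebraic kernel and the statement of one model-level estimate; nothing here bears on Navier–Stokes
regularity or blow-up; 23610 / 23612 / 23320 stay OPEN.

The idea (card `Ideas/kelvin-excision-surgery.md`): replace the self-induction symbol ABOVE the sub-Kelvin band `|kμ| ≤ 1` by a
sign-definite bending-type continuation (`exSym`), solve the EXCISED skeleton equation exactly (its linearisation has empty characteristic
set: H¹-coercive after testing with `J·`), and remove the `e^{-cη/μ}` excision defect of the analytic excised solution by one LOSSY
Kantorovich step.  This file supplies:

* `liaSym_le_neg_sq_subKelvin` — PROVED from the landed windows (p-lane 19175): `𝔖(x) ≤ −x²/64` on `0 < x ≤ 1`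
  (so the true multiplier `m = 2𝔖` is `≤ −x²/32` on the whole sub-Kelvin band, no band-limit to `|x| ≤ 1/10` needed);
* `ExcisionCutoff`, `exSym` — the excised symbol `𝔖̃_χ := (1−χ)𝔖 − χ·x²/64` and `exSym_le_neg_sq` — PROVED: `𝔖̃_χ(x) ≤ −x²/64` for ALL `x ≠ 0`;
* `ExcisedSpectralFormBound` (statement, = stub KS1 at model level): the lane's `spectralForm_le_neg_dirichlet` with the band-limit
  hypothesis REMOVED and `𝔖` replaced by `𝔖̃_χ`: `(1/2π)∫(2/q)𝔖̃_χ(z√q)|F|² ≤ −(1/32)∫‖f′‖²`;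
* `ExcisedModelDirichletEstimate` (statement): the lane's `model_lowRegime_dirichlet_estimate` for the EXCISED model operator, again with
  no band-limit hypothesis — the J-rotated (imaginary-part) energy identity is coercive on ALL of `H¹`.
-/

noncomputable section
set_option linter.dupNamespace false

open MeasureTheory Real Complex Set
open scoped ComplexConjugate
open Summit.NavierStokesRegularity.NavierStokesRegularity.Theorems.AnalyticStripLiaSymbol

namespace Summit.NavierStokesRegularity.NavierStokesRegularity.Cruxes.SkeletonJ1R.KelvinExcision

/-- **SUB-KELVIN NEGATIVITY OF THE SELF-INDUCTION SYMBOL** (proved from the landed windows `liaSym_le_quarter_sq_mul_log`,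
`liaSym_le_neg_mid_low`, `liaSym_le_neg_window_kernel`): `𝔖(x) ≤ −x²/64` for `0 < x ≤ 1`. -/
theorem liaSym_le_neg_sq_subKelvin (x : ℝ) (hx0 : 0 < x) (hx1 : x ≤ 1) : liaSym x ≤ -(x ^ 2 / 64) := by
  rcases le_or_gt x (1 / 10) with h | h
  · have h1 := liaSym_le_quarter_sq_mul_log x hx0 h
    have hlog : Real.log x ≤ -(9 / 10) := by
      have := Real.log_le_sub_one_of_pos hx0
      linarith
    have h2 : x ^ 2 / 4 * Real.log x ≤ x ^ 2 / 4 * (-(9 / 10)) :=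
      mul_le_mul_of_nonneg_left hlog (by positivity)
    nlinarith [sq_nonneg x]
  · rcases le_or_gt x (1 / 4) with h' | h'
    · have h1 := liaSym_le_neg_mid_low x h.le h'
      nlinarith [sq_nonneg x]
    · have h1 := liaSym_le_neg_window_kernel x (by linarith) hx1
      nlinarith [sq_nonneg x, mul_pos hx0 hx0]

/-- An ADMISSIBLE EXCISION CUT-OFF: `0 ≤ χ ≤ 1`, even, `χ = 1` above `|x| = 1` (where the true symbol is replaced).  Below `|x| = 1`
no constraint is needed for the SIGN (a convex combination of two sub-Kelvin-negative symbols is negative); the card takes `χ = 0` on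
`|x| ≤ 19/20` and `χ` Gevrey-smooth (locality of the excision operator, stub KS3) — requirements recorded on the card, not here. -/
structure ExcisionCutoff (χ : ℝ → ℝ) : Prop where
  nonneg : ∀ x, 0 ≤ χ x
  le_one : ∀ x, χ x ≤ 1
  eq_one : ∀ x, 1 < |x| → χ x = 1
  even : ∀ x, χ (-x) = χ x

/-- THE EXCISED ("Kelvin-free") SELF-INDUCTION SYMBOL `𝔖̃_χ(x) := (1 − χ(x))·𝔖(x) − χ(x)·x²/64`: the true symbol where `χ = 0`,
the bending-type symbol `−x²/64` above `|x| = 1`; it has NO ZERO except `x = 0` (the true `𝔖` vanishes at the Kelvin point `x* ≈ 1.11`). -/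
def exSym (χ : ℝ → ℝ) (x : ℝ) : ℝ := (1 - χ x) * liaSym x - χ x * (x ^ 2 / 64)

theorem exSym_neg {χ : ℝ → ℝ} (hχ : ExcisionCutoff χ) (x : ℝ) : exSym χ (-x) = exSym χ x := by
  simp only [exSym, liaSym_neg, hχ.even, neg_sq]

theorem exSym_le_neg_sq_of_pos {χ : ℝ → ℝ} (hχ : ExcisionCutoff χ) (x : ℝ) (hx : 0 < x) : exSym χ x ≤ -(x ^ 2 / 64) := by
  rcases le_or_gt x 1 with h | h
  · have h1 := liaSym_le_neg_sq_subKelvin x hx h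
    have h0 := hχ.nonneg x
    have h1' := hχ.le_one x
    have : (1 - χ x) * liaSym x ≤ (1 - χ x) * (-(x ^ 2 / 64)) :=
      mul_le_mul_of_nonneg_left h1 (by linarith)
    unfold exSym
    nlinarith
  · have hx1 : 1 < |x| := by rwa [abs_of_pos hx]
    simp [exSym, hχ.eq_one x hx1]

/-- **THE EXCISED SYMBOL IS SIGN-DEFINITE**: `𝔖̃_χ(x) ≤ −x²/64` for every `x ≠ 0` (PROVED). -/
theorem exSym_le_neg_sq {χ : ℝ → ℝ} (hχ : ExcisionCutoff χ) (x : ℝ) (hx : x ≠ 0) : exSym χ x ≤ -(x ^ 2 / 64) := by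
  rcases lt_or_gt_of_ne hx with h | h
  · have := exSym_le_neg_sq_of_pos hχ (-x) (by linarith)
    rw [exSym_neg hχ] at this
    simpa [neg_sq] using this
  · exact exSym_le_neg_sq_of_pos hχ x h

/-- The pointwise consequence used by the spectral form: `(2/q)·𝔖̃_χ(z√q) ≤ −z²/32` (PROVED; `q = μ²`-type core scale). -/
theorem scaled_exSym_le {χ : ℝ → ℝ} (hχ : ExcisionCutoff χ) {q : ℝ} (hq : 0 < q) (z : ℝ) :
    2 / q * exSym χ (z * √q) ≤ -(z ^ 2 / 32) := by
  by_cases hz : z = 0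
  · subst hz; simp [exSym, liaSym_zero]
  · have hsq : 0 < √q := Real.sqrt_pos.2 hq
    have hne : z * √q ≠ 0 := mul_ne_zero hz hsq.ne'
    have h1 := exSym_le_neg_sq hχ (z * √q) hne
    have h2 : 2 / q * exSym χ (z * √q) ≤ 2 / q * (-((z * √q) ^ 2 / 64)) :=
      mul_le_mul_of_nonneg_left h1 (by positivity)
    have hsq2 : (√q) ^ 2 = q := Real.sq_sqrt hq.le
    calc 2 / q * exSym χ (z * √q) ≤ 2 / q * (-((z * √q) ^ 2 / 64)) := h2
      _ = -(z ^ 2 / 32) := by rw [mul_pow, hsq2]; field_simp; ring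

/-- **KS1 AT MODEL LEVEL (statement).**  The lane's `spectralForm_le_neg_dirichlet` (p-lane 19175, `…Clause13ModelLowDirichlet` §2) with the
band-limit hypothesis `hsupp` REMOVED and the symbol excised: for every admissible cut-off, every `q > 0` and every `f ∈ C¹` with
`f, f′ ∈ L¹ ∩ L²`, `(1/2π)∫(2/q)𝔖̃_χ(z√q)·|F(z)|² dz ≤ −(1/32)·∫‖f′‖²` (`F` the un-normalised transform).  Pointwise it is `scaled_exSym_le`;
the integral step is `integral_norm_sq_deriv_eq_spectral` (landed) plus the lane's integrability bookkeeping. -/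
def ExcisedSpectralFormBound : Prop :=
  ∀ (χ : ℝ → ℝ), ExcisionCutoff χ → ∀ (q : ℝ), 0 < q → ∀ (f f' : ℝ → ℂ), (∀ x, HasDerivAt f (f' x) x) → Integrable f → MemLp f 2 →
    Integrable f' → MemLp f' 2 →
    1 / (2 * π) * ∫ z : ℝ, (2 / q * exSym χ (z * √q)) * ‖∫ x : ℝ, f x * cexp (I * z * x)‖ ^ 2
      ≤ -(1 / 32) * ∫ x : ℝ, ‖f' x‖ ^ 2

/-- The EXCISION CORRECTION as an operator (Fourier side): `(C_χ Y)(τ) := (1/2π)∫ (2/q)(𝔖̃_χ − 𝔖)(z√q)·Ŷ(z)·e^{−izτ} dz`, the multiplier that turns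
the true model self operator `M_q` (spectral side `(2/q)𝔖(z√q)`, `modelSelfForm_eq_spectral`) into the excised one.  It vanishes on every `Y`
whose transform lives in `{χ(z√q) = 0} ⊇ {|z|√q ≤ 19/20}` for the card's cut-off. -/
def excisionCorr (χ : ℝ → ℝ) (q : ℝ) (Y : ℝ → ℂ) (τ : ℝ) : ℂ :=
  (1 / (2 * π) : ℂ) * ∫ z : ℝ, ((2 / q * (exSym χ (z * √q) - liaSym (z * √q)) : ℝ) : ℂ)
    * (∫ x : ℝ, Y x * cexp (I * z * x)) * cexp (-(I * z * τ))

/-- **KS1, MODEL OPERATOR FORM (statement).**  The lane's `model_lowRegime_dirichlet_estimate` for the EXCISED model operator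
`𝓛̃Y = iG·(M_qY + C_χY) − wY′ + β₁Y + β₂conj Y`, with NO band-limit hypothesis: for `q, G > 0`, `Y ∈ C¹`, `Y, Y′ ∈ L¹∩L²`, `(τ−c)Y ∈ L²`,
`M_qY, C_χY ∈ L²`, `w` differentiable with `w(c) = 0`, `|w′| ≤ Λ`, `‖β_i‖ ≤ b_i`:
`G·(1/32)·∫‖Y′‖² ≤ ‖𝓛̃Y‖₂‖Y‖₂ + Λ‖Y′‖₂‖(τ−c)Y‖₂ + (b₁+b₂)‖Y‖₂²`.
With Poincaré on the doubled ball this is the Γ-free ellipticity `γ/(256π R_b²)·(1+o(1))` against transport `Λ·2R_b…`, i.e. coercive for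
`R_b ≤ R_b1(Λ, b₁+b₂, γ)` — for EVERY displacement, not only band-limited ones, because the excised symbol has no Kelvin zero. -/
def ExcisedModelDirichletEstimate : Prop :=
  ∀ (χ : ℝ → ℝ), ExcisionCutoff χ → ∀ (q G : ℝ), 0 < q → 0 < G →
  ∀ (Y Y' : ℝ → ℂ), (∀ τ, HasDerivAt Y (Y' τ) τ) → Integrable Y → MemLp Y 2 → Integrable Y' → MemLp Y' 2 →
  ∀ (c : ℝ), MemLp (fun τ : ℝ => ((τ - c : ℝ) : ℂ) * Y τ) 2 →
    MemLp (fun τ : ℝ => (2 / q : ℂ) * Y τ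
      - ∫ σ : ℝ, ((((2 * q - (τ - σ) ^ 2) * (((τ - σ) ^ 2 + q) ^ (5 / 2 : ℝ))⁻¹ : ℝ)) : ℂ) * Y σ) 2 →
    MemLp (excisionCorr χ q Y) 2 →
  ∀ (w : ℝ → ℝ), Differentiable ℝ w → ∀ (Λ : ℝ), (∀ t, |deriv w t| ≤ Λ) → w c = 0 →
  ∀ (β₁ β₂ : ℝ → ℂ), AEStronglyMeasurable β₁ volume → AEStronglyMeasurable β₂ volume → ∀ (b₁ b₂ : ℝ),
    (∀ τ, ‖β₁ τ‖ ≤ b₁) → (∀ τ, ‖β₂ τ‖ ≤ b₂) →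
    G * (1 / 32) * ∫ t : ℝ, ‖Y' t‖ ^ 2
      ≤ (∫ τ : ℝ, ‖I * (G : ℂ) * (((2 / q : ℂ) * Y τ
              - ∫ σ : ℝ, ((((2 * q - (τ - σ) ^ 2) * (((τ - σ) ^ 2 + q) ^ (5 / 2 : ℝ))⁻¹ : ℝ)) : ℂ) * Y σ) + excisionCorr χ q Y τ)
            - ((w τ : ℝ) : ℂ) * Y' τ + β₁ τ * Y τ + β₂ τ * conj (Y τ)‖ ^ 2) ^ (1 / 2 : ℝ) * (∫ τ : ℝ, ‖Y τ‖ ^ 2) ^ (1 / 2 : ℝ)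
        + Λ * ((∫ τ : ℝ, ‖Y' τ‖ ^ 2) ^ (1 / 2 : ℝ) * (∫ τ : ℝ, ‖((τ - c : ℝ) : ℂ) * Y τ‖ ^ 2) ^ (1 / 2 : ℝ))
        + (b₁ + b₂) * ∫ τ : ℝ, ‖Y τ‖ ^ 2

end Summit.NavierStokesRegularity.NavierStokesRegularity.Cruxes.SkeletonJ1R.KelvinExcision
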